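import Mathlib
import HarnessLib
import HarnessLib.Audit
import Summits.FinalStateConjecture.Statement
import Literature.Geometry.Lorentzian.ApproximateKerrConfiguration
import Literature.Geometry.Lorentzian.KerrSchild
import Literature.Geometry.Lorentzian.AdiabaticTracking

/-!
Route: RenormalisedDrift

DORMANT since 2026-09-04T18:33:14Z (reconciler: no traction for 5 d (last activity statement-checked at 2026-08-30T17:42:19Z); parked, not closed — `ledger route dormant route-FinalStateConjecture-RenormalisedDrift --off` to reactivate) — unstaffed, not closed; items shared with open routes are served there. `ledger route dormant <id> --off` reactivates.

# Route RenormalisedDrift — Secular capture: window-by-window proximity to the Kerr moduli space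
(parameters free to migrate by O(1)) upgrades to settling, by renormalised parameter drift

X = DriftCapture ∧ AdiabaticTracking — crux-only (ruling 2026-08-16; rev 5): the shared known
support MGHDExists (Choquet-Bruhat–Geroch) is a rung
toward AdiabaticTracking's anti-vacuity conjunct, not a hypothesis of `closes` —, realising card
secular-kerr-renormalised-drift.
The seam is ADIABATIC TRACKING of a vacuum MGHD 𝒟 at accuracy (ε, L, R₀) with complexity (N, m₀, χ)
— since rev 4 the landed
predicate `VacuumCauchyDevelopment.IsAdiabaticallyTracked 𝒟 N m₀ χ ε L R₀`
(Literature/Geometry/Lorentzian/AdiabaticTracking.lean,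
definitionally the block inlined at rev 0–3): a chain n ↦ cₙ of
ε-approximate N-Kerr configurations (`ApproximateKerrConfiguration 𝒟 O 2 ε 0 L Rₙ`, k = 2,
chart-time windows of length L,
near-zone radii Rₙ ≥ R₀ with Rₙ → ∞, masses in [m₀, 1/m₀], spins |aᵢ| ≤ χMᵢ) whose start slabs chain
(slab_{n+1}(0) ⊆ window image of cₙ),
which leave every compact past, and which together with J⁻ of the first slab cover the
self-determined exterior
O = J⁺(ιX) ∩ I⁻(⋃ₙ window images). THE KERR PARAMETERS OF DIFFERENT WINDOWS ARE UNRELATED: the chain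
may migrate by O(1) in (M, a)
(a hole doubling its mass under weak persistent infall is a tracked development). AdiabaticTracking
(front end): for TAME-Christodoulou-generic admissible data
(`IsTameChristodoulouGeneric … 1`, re-type T2: the escaping family lives on ONE fixed end, is
weighted-continuous at c = 0 and immersed)
an MGHD exists (anti-vacuity conjunct, folded in at rev 5) and every MGHD has complete 𝓘⁺ and, for
some (N, m₀, χ<1), is adiabatically
tracked at EVERY accuracy (all ε>0, L>0, R₀).
DriftCapture (the card's engine; rev 4 = the all-accuracy form C′, after the refuters'
quantifier-order paper witness against the rev-0
'ONE accuracy chosen before the data' form): for every (N, m₀, χ<1), an MGHD of admissible data with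
complete 𝓘⁺ tracked at EVERY
accuracy settles down exactly as the re-typed Statement demands (C² FinalStateDecomposition,
sub-extremal holes, O' = exteriorOf d.charted,
RaysStayInClosure O' — every future-complete normalised null ray from Σ stays in closure O' —,
HasExhaustiveCharts with honest growing
radii, IsFutureOriented) — orbital proximity to the MODULI SPACE (not to one Kerr) ⇒ asymptotic
stability, the content being that
cumulative parameter migration is renormalised into the background and its total is budgeted by the
first law; the chart clauses
(honest radii, future orientation) are outputs of the construction, the ray clause adds interior
null incompleteness.
Lean: `DriftCapture ∧ AdiabaticTracking`

## Assembly
Pure logic, sorry-free in Sketch.lean and in glue.lean (theorem `closes`, lean check rc 0): fix X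
and an admissible datum D; pointwise,
the tame-generic property of AdiabaticTracking gives the anti-vacuity conjunct (∃ MGHD) and, for
each MGHD 𝒟, (N, m₀, χ) and tracking
at EVERY accuracy, which is verbatim the hypothesis of DriftCapture (rev 4), and DriftCapture
returns the re-typed Statement's settling
clause (sub-extremal, O = exteriorOf, RaysStayInClosure, HasExhaustiveCharts, IsFutureOriented);
complete 𝓘⁺ is carried along. TAME
Christodoulou genericity (HasTameCodimAtLeastIn of the exceptional set) is monotone under pointwise
implication on the admissible class:
the tame immersed escaping family ⟨e, F⟩ through an exceptional datum of the weaker property serves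
verbatim for the Statement's property
(rev 5 `closes : DriftCapture → AdiabaticTracking → FinalStateConjecture`, crux-only, re-elaborated
against Statement p126844).
MGHDExists, SingleHoleDriftCapture and AdiabaticSchwarzschildEnergyBound are rungs, not hypotheses
of `closes`
(Sketch.lean: `adiabaticTracking_of_pure : MGHDExists → AdiabaticTrackingPure → AdiabaticTracking`,
`single_of_drift`).

Rationale: WHY THIS LINE. Mechanism (card secular-kerr-renormalised-drift): expand g = g_Kerr(λ(t̃)) + εh₁ +
ε²h₂ + … with the Kerr parameters λ = (M, a, frame)
modulated on the slow time t̃ = ε²t/M; the Chen–Goldenfeld–Oono renormalisation group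
(arXiv:hep-th/9506161; multiple scales) says the
expansion is uniformly valid iff every secular (t-polynomial, zero-frequency) response of the
linearised Einstein operator lies in
T_λ(Kerr family) ⊕ gauge — which is exactly LINEAR NO-HAIR (Wald doi:10.1063/1.1666203;
HafnerHintzVasy2019, arXiv:1903.03859 at zero
energy) — and the RG equation is the first law fed by Teukolsky–Press absorption
(TeukolskyPress1974): dM/dt̃ = 𝓕_𝓗[h₁] ≥ 0 off the
superradiant band. Post-renormalisation errors are ε³ per unit time, so amplitude-ε forcing of total
energy O(M) (duration ε⁻²M) costs ε:
a black hole can double its mass inside perturbation theory. Imported: singular perturbation theory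
/ RG for secular terms (applied
mathematics), modulation theory of soliton dynamics (orbital ⇒ asymptotic stability along a manifold
of equilibria), the physical-space
Kerr machinery (DafermosRodnianskiShlapentokhrothman2014, ShlapentokhrothmanCosta2023,
KlainermanSzeftel2023, GiorgiKlainermanSzeftel2022,
arXiv:2212.14093). What it does that the 40 sibling routes do not: every capture crux on this summit
(QuietWindowCapture.Capture,
ResolvedTimelikeInfinity.SingleKerrOrbitalCapture, PhaseMixingCapture.BulkKerrCapture,
EIHFluxBalance.ModulatedKerrHandoff) either
starts ε-close to ONE Kerr in a weighted norm or modulates positions at FIXED (Mᵢ, aᵢ); here the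
hypothesis is closeness to the Kerr
MODULI SPACE window by window in the unweighted C² vocabulary the Statement itself uses, and
"parameters converge" is a conclusion.
Negatives index: empty at filing (0 refuted statements).

RANKED CRUXES. #2 DriftCapture (crux) — (card K1+K2+K3 as ONE capture theorem; general N; rev 4 =
repaired all-accuracy form C′ with the re-typed conclusion) for every N, m₀ > 0, 0 ≤ χ < 1: every
maximal vacuum Cauchy development of an admissible datum with complete 𝓘⁺ which is ADIABATICALLY
TRACKED AT EVERY ACCURACY with complexity (N, m₀, χ) — for all L > 0, ε > 0, R₀,
`IsAdiabaticallyTracked 𝒟 N m₀ χ ε L R₀`: a chain of ε-approximate N-Kerr configurations in C² on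
windows of chart-length L, radii Rₙ ≥ R₀, Rₙ → ∞, masses in [m₀, 1/m₀], |aᵢ| ≤ χMᵢ, chained start
slabs, leaving every compact past, covering O = J⁺(ιX) ∩ I⁻(⋃ windows) together with J⁻(first slab);
parameters of different windows UNRELATED — settles down as in the re-typed Statement: a C²
FinalStateDecomposition d of some O' with sub-extremal holes, O' = exteriorOf 𝒟 d.charted,
RaysStayInClosure 𝒟 O', HasExhaustiveCharts d (honest growing radii), IsFutureOriented d. To be
proved by the renormalised (parameter-re-anchored) GKS/DHRT bootstrap: drift-uniform linear
estimates (K1), re-anchoring on slow steps (K2), zero-frequency solvability = linear no-hair (K3),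
first-law budget of the total migration; future-oriented honest charts come out of the construction,
the ray clause needs interior null incompleteness. The rev-0 one-accuracy form (∃(L, ε, R₀) before ∀
data) implied this one and stands refuted-misstated on paper (N = 0 sub-accuracy packet train;
rattack evidence on stmt-FinalStateConjecture-10853); C′ is exactly what AdiabaticTracking delivers.
[difficulty: open-problem] (why it might fail: All-accuracy unweighted C² tracking carries no
first-law budget: parameters may wander adiabatically forever (rate → 0, cumulative O(1));
drift-uniform ILED through the moving threshold mΩ_H(t) is unproved even for □_g; the conclusion
also asserts interior null incompleteness (RaysStayInClosure).) [KlainermanSzeftel2023,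
GiorgiKlainermanSzeftel2022, arXiv:2212.14093, DafermosRodnianskiShlapentokhrothman2014,
ShlapentokhrothmanCosta2023, HafnerHintzVasy2019, arXiv:1903.03859, doi:10.1063/1.1666203,
TeukolskyPress1974, arXiv:1908.09095, arXiv:2006.11263, arXiv:hep-th/9506161, DafermosLuk2017,
Bieri2010JDG]
#3 AdiabaticTracking (crux) — (front end, imported pre-phase; rev 4: tame genericity, re-type T2)
for every connected Hausdorff second-countable 3-manifold X, TAME-Christodoulou-generically (tame
codimension ≥ 1: the escaping family lives on ONE fixed end, is weighted-C² × C¹-continuous at c = 0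
and immersed; `IsTameChristodoulouGeneric … 1`) in admissibleVacuumData X: a maximal vacuum Cauchy
development EXISTS (anti-vacuity conjunct, folded in at rev 5 so that `closes` is crux-only; true
for all data by Choquet-Bruhat–Geroch = the support MGHDExists) and every maximal vacuum Cauchy
development has complete 𝓘⁺ (Summit.FinalStateConjecture.HasCompleteNullInfinity) and there are N,
m₀ > 0, 0 ≤ χ < 1 such that for ALL L > 0, ε > 0, R₀ it is adiabatically tracked at accuracy (ε, L,
R₀) with complexity (N, m₀, χ) (`VacuumCauchyDevelopment.IsAdiabaticallyTracked`, the landed seam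
predicate). Orbital convergence to the moduli space of receding sub-extremal multi-Kerr
configurations, with margin, in the Statement's own C² chart vocabulary; weak cosmic censorship and
the third-law margin are bundled into the one generic statement because curve-genericity is not
closed under conjunction. [difficulty: open-problem] (why it might fail: Contains weak cosmic
censorship and 'no eternal non-Kerr vacuum dynamics' (breathers, endless merger cascades, parking at
extremality) outright; N, m₀, χ uniform in ε presume a last merger and a generic third law
(Kehle–Unger: extremal horizons form); witness families must now be TAME on one fixed end and
immersed; C² i⁰-tails at k = 2 only.) [DafermosLuk2017, Christodoulou1999, Christodoulou2008,
KehleUnger2024, KehleUnger2025, Klainerman2025, DafermosRodnianski2008, arXiv:2601.01517]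
#4 AdiabaticSchwarzschildEnergyBound (crux) — (card K1 in its cheapest refutable form = the card's
Fastest refutation, typed) LINEAR WAVES ON AN ADIABATICALLY ACCRETING SCHWARZSCHILD BACKGROUND ARE
UNIFORMLY BOUNDED. Background: ingoing Kerr–Schild/Eddington–Finkelstein form g = η + (2μ(t*)/r) ℓ⊗ℓ
on ℝ⁴ (wave operator `KerrSchild.waveOperator (KerrSchild.inverseMetric (2μ(x⁰)/r) ℓ♯)`), with a
smooth nondecreasing mass function μ, μ(0) = M₀ ≤ μ ≤ 2M₀, μ̇ ≤ η₀, |μ̈| ≤ η₀/M₀ (total migration up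
to 100%, arbitrarily slow). Claim: for every M₀ > 0 there is η₀ > 0 and (a) C < ∞ such that every
smooth u solving □u = 0 on {t* ≥ 0, r > μ(t*)} with compactly supported Cauchy data in {r > M₀} has
coordinate energy ∫_{r ≥ 2μ(τ) − M₀/2} |∂u|²(τ) ≤ C ∫_{r ≥ M₀} |∂u|²(0) for all τ ≥ 0; (b) for every
R a C_R < ∞ with ∫₀^∞ ∫_{2μ(τ)−M₀/2 ≤ r ≤ R} |∂u|² ≤ C_R ∫ (|∂u|² + |∂²u|²)(0) (integrated local
energy decay losing one derivative at the drifting photon sphere). Constants independent of the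
duration M₀/η₀ of the drift — the whole point. [difficulty: L] (why it might fail: No conserved
energy: the ∂_t*-flux identity gains a bulk ∫ μ̇·𝕋[u] ≲ η₀·E_loc whose integral over time M₀/η₀ is
O(1)·sup E unless local energy decays integrably near the drifting photon sphere r = 3μ(t); slowly
pumped low-frequency tails (no spectral gap) may grow.) [arXiv:2405.08659, arXiv:2205.10229,
arXiv:gr-qc/0309115, DafermosRodnianski2009, DafermosRodnianski2008, Moschidis2016,
DafermosRodnianski2011]
#9 SingleHoleDriftCapture (support) — the N = 1 instance of DriftCapture (rev 4: all-accuracy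
hypothesis, re-typed conclusion; one hole; the card's literal regime: a single black hole tracked
window by window while it absorbs weak persistent radiation and migrates by O(1) in (M, a)); implied
by DriftCapture (Sketch.lean `single_of_drift`), filed as the informative first rung for provers and
refuters. [difficulty: open-problem] [KlainermanSzeftel2023, GiorgiKlainermanSzeftel2022,
TeukolskyPress1974, arXiv:gr-qc/0309115]
#9 MGHDExists (support) — every admissible datum has a maximal vacuum Cauchy development over the
repaired structure (`VacuumCauchyDevelopment … IsMaximal`); Choquet-Bruhat–Geroch 1969 Thm 3,
Sbierski 2016 Thm 2.6 — the anti-vacuity conjunct, since rev 5 no hypothesis of `closes` (crux-only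
ruling) but the rung MGHDExists → AdiabaticTrackingPure → AdiabaticTracking (Sketch.lean
`adiabaticTracking_of_pure`); filed with the verbatim signature of the sibling routes' shared item
(stmt-FinalStateConjecture-9937) so that it deduplicates onto it; closable by
`choquetBruhat_geroch_exists_mghd_cauchy.forall_mem_admissibleVacuumData`
(AdmissibleMGHDExistence.lean) once that named fact is granted. [difficulty: XL]
[ChoquetBruhatGeroch1969CMP, Ringstrom2009, Sbierski2016AHP]

TWO-LAYER PLAN. Foreseen glued splits (none filed now; k ≤ 3, depth 1). DriftCapture ⇐
DriftUniformLinearTheory (card K1: boundedness + ILED with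
inhomogeneity for the Teukolsky/gRW system on backgrounds g_Kerr(λ(t*)) with |λ̇| ≤ Cε², λ in a
compact sub-extremal set, constants
independent of elapsed time; AdiabaticSchwarzschildEnergyBound is its a = 0, scalar floor) →
RenormalisedBootstrap (card K2+K3: GKS/DHRT
scheme with GCM spheres re-anchored along the drifting family on slow steps, zero-frequency
solvability = linear no-hair in the
t-polynomial, horizon-regular form, first-law budget Σ|δλ| ≤ C·(absorbed energy) < ∞ giving
parameter convergence; single hole) →
RecedingAssembly (N holes with Rₙ → ∞: time-integrable tidal coupling O(M²/D³), far-field patching,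
exhaustive charts) → DriftCapture.
AdiabaticTracking ⇐ CensorshipLeg (generic complete 𝓘⁺) → FinalEraTracking (generic: after the last
strong-field event the exterior
tracks the moduli space at every accuracy, with margin) → AdiabaticTracking, glued by a
joint-transversality statement.

KILL CRITERIA. refuted:AdiabaticSchwarzschildEnergyBound (a family of adiabatic mass functions and
finite-energy waves whose near-zone energy is amplified
without bound as η₀ → 0 — parametric pumping) kills the mechanism at its linear floor: close
`refuted:AdiabaticSchwarzschildEnergyBound`
unless the witness needs μ̈ ≁ 0 tuning excluded by a cheap restatement (then `--restate` once).
refuted:DriftCapture by a vacuum development tracked forever AT EVERY ACCURACY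
that never settles (perpetual parameter wandering with finite energy, an eternal wide binary passing
every window test)
closes the route and hands the witness to ResolvedTimelikeInfinity / QuietWindowCapture as negative
knowledge. refuted:AdiabaticTracking
through an open set of admissible data with incomplete 𝓘⁺ is ¬WCC and kills every route of the
summit as typed; refuted only through the
uniformity clauses (N, m₀, χ independent of ε; chaining) forces a PIVOT (`--restate` the seam), not
a close. Mooted (supersede) if a
sibling proves its capture crux from a one-Kerr weighted hypothesis AND its front end delivers that
hypothesis.

NOT DECOMPOSED YET. K1 for Kerr (a ≠ 0: needs a typed Teukolsky/wave operator on the drifting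
Kerr–Schild background and the drifting superradiant
threshold), K2 (re-anchored GCM bootstrap), K3 (linear no-hair for t-polynomial zero-frequency
perturbations, full sub-extremal range,
horizon-regular — wanted verbatim by several rigidity cards), K4 (sub-extremality along the flux
ODE; here absorbed into the margin χ of
the seam and made generic in AdiabaticTracking), the first-law migration budget as a separate lemma,
the Cauchy-data form of the card's
theorem-target (P1 data: Kerr inside, amplitude-ε train of length ε⁻²M outside — needs an
amplitude-type, not energy-type, data norm),
the formal RG computation P3 (Vaidya-like scalar model), and the multi-hole receding assembly — all
layer-2 children of DriftCapture.
The regularity gap (C² hypothesis vs derivative-hungry bootstrap) is deliberately left inside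
DriftCapture.

CHEAPEST FALSIFIER. 1+1 numerics of AdiabaticSchwarzschildEnergyBound (kit-sized, the card's Fastest
refutation): the ℓ = 0, 1, 2 reductions of □_g u = 0 for
g = η + (2μ(t*)/r)ℓ⊗ℓ with μ = M₀(1 + ½(1 + tanh(η₀(t* − t₀)/M₀))), η₀ ∈ {0.04, 0.02, 0.01, 0.005};
compare sup_τ E(τ)/E(0) and
∫E_loc with the static values. Growth of either ratio as η₀ ↓ 0 refutes the crux and demotes the
route; boundedness uniform in η₀ is the
expected outcome (red-shift and Morawetz multipliers deform continuously in μ; DR prove Price-law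
decay on mass-growing spherically
symmetric backgrounds, arXiv:gr-qc/0309115). Submitted from this session as a kit job if the queue
accepts it (job id in NOTES.md /
item evidence); lookup half done: Coudray (arXiv:2205.10229, arXiv:2405.08659) treats □ on Vaidya
only for mass changes on a FINITE
advanced/retarded-time interval with Gronwall-type constants and states that decay results on Vaidya
do not exist — so the uniform-in-
duration statement is open but adjacent to print.

NUMBERS. Regime: near-zone amplitude ε, incident flux ≍ ε² per time M, duration T ≍ ε⁻²M, absorbed
energy ≍ M (mass doubling); renormalised error
ε³·T/M = ε (card). Linear toy: μ: M₀ ↗ ≤ 2M₀, rate ≤ η₀, duration ≥ M₀/η₀; horizon 2μ ∈ [2M₀, 4M₀],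
photon sphere 3μ, energies on
{r ≥ 2μ(τ) − M₀/2}, equation on {r > μ(t*)}. Perturbative reach in print: Kerr stability for |a|/M ≪
1 with final parameters
ε-close to initial (KlainermanSzeftel2023, GiorgiKlainermanSzeftel2022); linear Teukolsky
boundedness/decay for all |a| < M
(ShlapentokhrothmanCosta2020, ShlapentokhrothmanCosta2023); quasilinear waves on the full
sub-extremal range (arXiv:2212.14093);
Teukolsky–Press absorption: dM/dt − Ω_H dJ/dt ≥ 0 mode by mode off ω < mΩ_H (TeukolskyPress1974).
Items at open: 6 (3 cruxes, 2 support,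
1 assembly); at rev 4–5: 6 (2 cruxes, 3 support, 1 assembly; `closes` crux-only from rev 5); k = 2
throughout (the admissible o₂(r⁻¹) class controls two derivatives at i⁰).

DEFINITION REQUESTS. Both LANDED (Literature/Geometry/Lorentzian/AdiabaticTracking.lean,
AdiabaticKerrSchildBackground.lean); the three seam items are restated over (1) since rev 4. As
filed: (1) notion IsAdiabaticallyTracked — `VacuumCauchyDevelopment.IsAdiabaticallyTracked 𝒟 N m₀ χ
ε L R₀ : Prop`, verbatim the ∃-block
inlined twice in DriftCapture / AdiabaticTracking / SingleHoleDriftCapture (chain of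
`ApproximateKerrConfiguration 𝒟.toSpacetime O 2 ε 0 L (R n)`
with radii, complexity, chaining, exhaustion, pinning and covering clauses), topic
Literature/Geometry/Lorentzian, so that tenure can
restate the three items over it and file K1–K3 as children. (2) notion AdiabaticKerrSchildBackground
— the generalised Kerr–Schild
coefficient field of g_Kerr(M(t*), a(t*)) (profile 2H, null vector ℓ♯ of the instantaneous
parameters) as a `KerrSchild.Background`-like
structure with slow-variation bounds, topic Literature/Geometry/Lorentzian, needed to type K1 for a
≠ 0. Cite facts wanted (family gr):
Wald 1973 (stationary perturbations of Kerr are parameter variations + gauge;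
doi:10.1063/1.1666203); Teukolsky–Press 1974 absorption /
first-law flux inequality (TeukolskyPress1974).

Novelty: Searches (2026-08-15, this session): `lit galaxy search "Vaidya spacetime" --star all` (13 rows:
Coudray–Nicolas arXiv:2101.06544 geometry
of Vaidya; textbooks), `"adiabatic black hole"` (2, astrophysics), `"two-timescale expansion"` (6:
Miller–Pound EMRI two-timescale, Pound
2015 — formal, small drift), `"slowly varying mass"` (12, none on BH wave decay), `"renormalization
group secular"` (0);
`lit search --source zbmath "wave equation Vaidya decay"` (2: Coudray arXiv:2205.10229 peeling on
Vaidya, arXiv:2405.08659 conformal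
scattering on Vaidya — read pp. 1–4: finite-duration mass change, "similar [decay] results do not
exist on the Vaidya spacetime");
`--source crossref` (8, irrelevant damped-wave hits); arXiv/OpenAlex/S2 APIs rate-limited (HTTP
429), local searchd unavailable (rc 75) —
recorded for the grader; `lit frontier FinalStateConjecture --since 2021` (30 rows; nearest
arXiv:2212.14093 quasilinear waves on Kerr,
arXiv:2112.07183 Kerr–de Sitter, arXiv:2601.01517 multi-BH data — no drifting-parameter stability
target); `lit bridges --cross any`
(surveys only); the 40 sibling Theses files grepped for adiabatic|secular|renormalis|drift (hits
only in other senses: receding holes,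
future-drifting charts, Łojasiewicz 'drift killed'); card-level searches of the ideate and
novelty-audit units (CGO, Hinderer–Flanagan,
Miller–Pound arXiv:2006.11263, Green–Hollands–Zimmerman arXiv:1908.09095, Wald 1973, DR
gr-qc/0309115, Hintz arXiv:2408.06715).
Nearest prior art found: arXiv:2  [refs: 2101.06544, 2205.10229, 2405.08659, 2212.14093, 2112.07183, 2601.01517, 2006.11263, 1908.09095, 2408.06715, gr-qc/0309115, KlainermanSzeftel2023, GiorgiKlainermanSzeftel2022]

Barriers (technique_class: multiple-scales, modulation, energy-morawetz): - technique_class: multiple-scales, modulation, energy-morawetz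
- Literature.Barriers.FinalStateConjecture.SlowlyRotatingKerrFrontier: not evaded — DriftCapture for
|a| ≪ M throughout the migration (M doubles while a stays small: the RG flow of an untuned train) is
the first target, where GKS is in print; the full range would ride on SR–TdC's linear theory; the
bet is that drift-uniformity, not large a, is the new difficulty.
- Literature.Barriers.FinalStateConjecture.KerrSuperradiance: no Killing-energy positivity is used;
K1 rides on frequency-localised DRSR/SR–TdC estimates, and the drifting threshold mΩ_H(t) is named
as DriftCapture's specific danger; the typed floor AdiabaticSchwarzschildEnergyBound is a = 0 (no
superradiance) on purpose — it isolates the pumping/no-gap issue.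
- Literature.Barriers.FinalStateConjecture.KerrSuperradianceNarrow: same as KerrSuperradiance.
- Literature.Barriers.FinalStateConjecture.PriceLawTail: tails are why no adiabatic theorem with a
gap exists; the items claim rate-free boundedness + integrated decay uniform in the drift and
settling WITHOUT a rate, which t⁻³ tails permit.
- Literature.Barriers.FinalStateConjecture.AretakisInstability: evaded by the margin — every window
has |aᵢ| ≤ χMᵢ, χ < 1, so κ ≥ κ(χ) > 0 along the whole migration; spin-up trains tuned to ω ≈ mΩ_H
(Kehle–Unger-type third-law violation) are put in the exceptional set by AdiabaticTracking,
consistent with the barrier.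
- Literature.Barriers.FinalStateConjecture.Aretaki

History (route lifecycle, newest last):
- 2026-08-15T16:33:48Z · rev 1: restated AdiabaticSchwarzschildEnergyBound (stmt-FinalStateConjecture-10855) — cone repair (route-repair planner): all 15 unproved named facts in the import cone (drsr_*/srtdc_* Kerr wave estimates, christodoulou_trapped_surface_formation, (planner-rrepair-FinalStateConjecture-Renormali-7fb85d4e-0)
- 2026-08-16T23:18:17Z · rev 4: restated DriftCapture (stmt-FinalStateConjecture-10853), AdiabaticTracking (stmt-FinalStateConjecture-10854), SingleHoleDriftCapture (stmt-FinalStateConjecture-10856) — route-repair (statement-revised p126844, re-type T2) folded with the pending refuted-misstated repair of DriftCapture: restated DriftCapture 1:1 (planner-rrepair-FinalStateConjecture-Renormali-03e18997-0)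
- 2026-08-16T23:20:46Z · rev 5: restated AdiabaticTracking (stmt-FinalStateConjecture-17392), Assembly (stmt-FinalStateConjecture-10857) — route-repair (statement-revised p126844) step 2 — CRUX-ONLY deciding theorem (gate needs_repair glue.non-crux-hypothesis on rev 4: `closes` assumed the support (planner-rrepair-FinalStateConjecture-Renormali-03e18997-0)
- 2026-08-24T14:41:13Z · DORMANT — reconciler: no traction for 6.8 d (last activity item-evidence-added at 2026-08-17T18:09:00Z); parked, not closed — `ledger route dormant route-FinalStateConjec (operator:999:1729734)
- 2026-08-30T17:07:33Z · REACTIVATED (open) — reconciler: reactivated — activity statement-checked at 2026-08-30T15:54:01Z after parking at 2026-08-24T14:41:13Z (operator:999:456953)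
- 2026-09-04T18:33:14Z · DORMANT — reconciler: no traction for 5 d (last activity statement-checked at 2026-08-30T17:42:19Z); parked, not closed — `ledger route dormant route-FinalStateConjecture (operator:999:2123803)

sub-problem: FinalStateConjecture · status: dormant · opened planner-plancard-FinalStateConjecture-FinalSt-bc34e3d5-0 2026-08-15T16:25:18Z · rev 6 · ledger route-FinalStateConjecture-RenormalisedDrift
GENERATED by the gate from the ledger (D-0016/17). Provers cite these decls: `theorem foo : Summit.FinalStateConjecture.FinalStateConjecture.Theses.RenormalisedDrift.<Decl> := …` in Summits/FinalStateConjecture/FinalStateConjecture/Theorems/<Name>.lean.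
-/

namespace Summit.FinalStateConjecture.FinalStateConjecture.Theses.RenormalisedDrift

open scoped BigOperators Topology Manifold Classical MeasureTheory ProbabilityTheory Matrix InnerProductSpace ComplexConjugate ContinuousMap
open Filter Set Function TopologicalSpace MeasureTheory

attribute [summit_statement] _root_.FinalStateConjecture

-- earlier DriftCapture (stmt-FinalStateConjecture-10853, replaced 2026-08-16T23:18:17Z -> stmt-FinalStateConjecture-17391): retired by None — open Literature.Geometry.Lorentzian in ∀ (N : ℕ) (m₀ χ : ℝ), 0 < m₀ → 0 ≤ χ → χ < 1 → ∃ (L : ℝ) (ε : ENNReal) (R₀ : ℝ), 0 < L ∧ 0 < ε ∧ ∀ (X : Type) [TopologicalSpace X] [ChartedSpace E3 X] [IsManifold (𝓡 3) ((⊤ : ℕ∞) : WithTop ℕ∞) X] [T2Space X] [SecondCounta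
/-- item stmt-FinalStateConjecture-17391 · crux · rank 2 · open · by planner
why it might fail: All-accuracy unweighted C² tracking carries no first-law budget: parameters may wander adiabatically forever (rate → 0, cumulative O(1)); drift-uniform ILED through the moving threshold mΩ_H(t) is unproved even for □_g; the conclusion also asserts interior null incompleteness (RaysStayInClosure).
sources: KlainermanSzeftel2023, GiorgiKlainermanSzeftel2022, ShlapentokhrothmanCosta2023, arXiv:2212.14093, DafermosRodnianskiShlapentokhrothman2014, Klainerman2025
[crux] (card K1+K2+K3 as ONE capture theorem; general N; rev 4 = the repaired all-accuracy form C′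
with the re-typed conclusion) for every N, m₀ > 0, 0 ≤ χ < 1: every maximal vacuum Cauchy
development of an admissible datum with complete 𝓘⁺ which is ADIABATICALLY TRACKED AT EVERY ACCURACY
with complexity (N, m₀, χ) — for all L > 0, ε > 0, R₀: `IsAdiabaticallyTracked 𝒟 N m₀ χ ε L R₀`, a
chain of ε-approximate N-Kerr configurations in C² on windows of chart-length L, radii Rₙ ≥ R₀, Rₙ →
∞, masses in [m₀, 1/m₀], |aᵢ| ≤ χMᵢ, chained start slabs, leaving every compact past, covering O =
J⁺(ιX) ∩ I⁻(⋃ windows) with J⁻(first slab); parameters of different windows UNRELATED (cumulative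
O(1) migration allowed) — settles down exactly as the re-typed Statement demands: a C²
FinalStateDecomposition d of some O' with sub-extremal holes, O' = exteriorOf 𝒟 d.charted,
RaysStayInClosure 𝒟 O' (every future-complete normalised null ray from Σ stays in closure O'),
HasExhaustiveCharts d (honest growing radii Rᵢ(τ) ≥ max(r₊, 0) + 1, Rᵢ → ∞), IsFutureOriented d.
Exterior part by the renormalised (parameter-re-anchored) GKS/DHRT bootstrap: drift-uniform linear
estimates (K1), re-anchoring on slow steps ( -/
@[route_item "route-FinalStateConjecture-RenormalisedDrift"]
def DriftCapture : Prop :=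
  open Literature.Geometry.Lorentzian in ∀ (N : ℕ) (m₀ χ : ℝ), 0 < m₀ → 0 ≤ χ → χ < 1 → ∀ (X : Type) [TopologicalSpace X] [ChartedSpace E3 X] [IsManifold (𝓡 3) ((⊤ : ℕ∞) : WithTop ℕ∞) X] [T2Space X] [SecondCountableTopology X] [ConnectedSpace X], ∀ D ∈ admissibleVacuumData X, ∀ 𝒟 : VacuumCauchyDevelopment D, 𝒟.IsMaximal → Summit.FinalStateConjecture.HasCompleteNullInfinity 𝒟.toCauchyDevelopment → (∀ (L : ℝ) (ε : ENNReal) (R₀ : ℝ), 0 < L → 0 < ε → 𝒟.IsAdiabaticallyTracked N m₀ χ ε L R₀) → ∃ (O' : Set 𝒟.carrier) (d : FinalStateDecomposition 𝒟.toSpacetime O' 2), (∀ i, Kerr.IsSubextremal (d.mass i) (d.spin i)) ∧ O' = Summit.FinalStateConjecture.exteriorOf 𝒟.toCauchyDevelopment d.charted ∧ Summit.FinalStateConjecture.RaysStayInClosure 𝒟.toCauchyDevelopment O' ∧ Summit.FinalStateConjecture.HasExhaustiveCharts d ∧ Summit.FinalStateConjecture.IsFutureOriented d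

-- earlier AdiabaticTracking (stmt-FinalStateConjecture-10854, replaced 2026-08-16T23:18:17Z -> stmt-FinalStateConjecture-17392): retired by None — open Literature.Geometry.Lorentzian in ∀ (X : Type) [TopologicalSpace X] [ChartedSpace E3 X] [IsManifold (𝓡 3) ((⊤ : ℕ∞) : WithTop ℕ∞) X] [T2Space X] [SecondCountableTopology X] [ConnectedSpace X], InitialDataSet.IsChristodoulouGeneric (admissibleVacuumDa
-- earlier AdiabaticTracking (stmt-FinalStateConjecture-17392, replaced 2026-08-16T23:20:46Z -> stmt-FinalStateConjecture-17504): retired by None — open Literature.Geometry.Lorentzian in ∀ (X : Type) [TopologicalSpace X] [ChartedSpace E3 X] [IsManifold (𝓡 3) ((⊤ : ℕ∞) : WithTop ℕ∞) X] [T2Space X] [SecondCountableTopology X] [ConnectedSpace X], InitialDataSet.IsTameChristodoulouGeneric (admissibleVacu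
/-- item stmt-FinalStateConjecture-17504 · crux · rank 3 · open · by planner
why it might fail: Bundles generic WCC, finitely many mergers, a third-law margin χ<1 (Kehle–Unger: extremal horizons form) and tracking at EVERY C² accuracy; witness families must now be TAME on one fixed end and immersed (lines α₀+cf): false if extremal ends or eternal non-Kerr dynamics are not tame-codim ≥ 1.
sources: Christodoulou1999, DafermosLuk2017, KehleUnger2025, KehleUnger2024, Klainerman2025, AlexakisSchlue2018
[crux] (front end, imported pre-phase; rev 4: tame genericity, re-type T2; rev 5: anti-vacuity
conjunct folded in, crux-only `closes`) for every connected Hausdorff second-countable 3-manifold X,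
TAME-Christodoulou-generically in admissibleVacuumData X (tame codimension ≥ 1: through every
exceptional datum passes an injective one-parameter family of admissible data living on ONE fixed
asymptotically flat end, weighted-C²₋₁ × C¹₋₂-continuous at c = 0 and immersed there, all of whose
other members are good; `IsTameChristodoulouGeneric … 1`): a maximal vacuum Cauchy development
EXISTS (true for all admissible data by Choquet-Bruhat–Geroch = the support MGHDExists; carried here
so that the deciding theorem is crux-only) and every maximal vacuum Cauchy development has complete
𝓘⁺ (Summit.FinalStateConjecture.HasCompleteNullInfinity) and there are N, m₀ > 0, 0 ≤ χ < 1 such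
that for ALL L > 0, ε > 0, R₀ it is adiabatically tracked at accuracy (ε, L, R₀) with complexity (N,
m₀, χ) (`VacuumCauchyDevelopment.IsAdiabaticallyTracked`, the landed seam predicate, definitionally
the block inlined at rev 0–3). Orbital convergence to the moduli space of receding sub-extremal
multi-Kerr configuratio -/
@[route_item "route-FinalStateConjecture-RenormalisedDrift"]
def AdiabaticTracking : Prop :=
  open Literature.Geometry.Lorentzian in ∀ (X : Type) [TopologicalSpace X] [ChartedSpace E3 X] [IsManifold (𝓡 3) ((⊤ : ℕ∞) : WithTop ℕ∞) X] [T2Space X] [SecondCountableTopology X] [ConnectedSpace X], InitialDataSet.IsTameChristodoulouGeneric (admissibleVacuumData X) (fun D ↦ (∃ 𝒟 : VacuumCauchyDevelopment D, 𝒟.IsMaximal) ∧ ∀ 𝒟 : VacuumCauchyDevelopment D, 𝒟.IsMaximal → Summit.FinalStateConjecture.HasCompleteNullInfinity 𝒟.toCauchyDevelopment ∧ ∃ (N : ℕ) (m₀ χ : ℝ), 0 < m₀ ∧ 0 ≤ χ ∧ χ < 1 ∧ ∀ (L : ℝ) (ε : ENNReal) (R₀ : ℝ), 0 < L → 0 <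 ε → 𝒟.IsAdiabaticallyTracked N m₀ χ ε L R₀) 1

-- earlier AdiabaticSchwarzschildEnergyBound (stmt-FinalStateConjecture-10855, replaced 2026-08-15T16:33:48Z -> stmt-FinalStateConjecture-10977): retired by None — open Literature.Geometry.Lorentzian in ∀ M₀ : ℝ, 0 < M₀ → ∃ η₀ : ℝ, 0 < η₀ ∧ (∃ C : ENNReal, C ≠ ⊤ ∧ ∀ μ : ℝ → ℝ, ContDiff ℝ ((⊤ : ℕ∞) : WithTop ℕ∞) μ → Monotone μ → μ 0 = M₀ → (∀ t, μ t ≤ 2 * M₀) → (∀ t, deriv μ t ≤ η₀ ∧ |deriv (deriv μ) 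
/-- item stmt-FinalStateConjecture-10977 · support · rank 4 · open · by planner
why it might fail: No conserved energy: the ∂_t*-flux identity gains a bulk ∫ μ̇·𝕋[u] ≲ η₀·E_loc whose integral over time M₀/η₀ is O(1)·sup E unless local energy decays integrably near the drifting photon sphere r = 3μ(t); slowly pumped low-frequency tails (no spectral gap) may grow.
sources: DafermosRodnianski2008, DafermosRodnianski2005, DafermosRodnianski2003, MetcalfeTataruTohaneanu2011, DafermosRodnianski2009, Moschidis2016
[crux] (card K1 in its cheapest refutable form = the card's Fastest refutation, typed) LINEAR WAVES
ON AN ADIABATICALLY ACCRETING SCHWARZSCHILD BACKGROUND ARE UNIFORMLY BOUNDED. Background: ingoing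
Kerr–Schild/Eddington–Finkelstein form g = η + (2μ(t*)/r) ℓ⊗ℓ on ℝ⁴ with a smooth nondecreasing mass
function μ, μ(0) = M₀ ≤ μ ≤ 2M₀, μ̇ ≤ η₀, |μ̈| ≤ η₀/M₀ (total migration up to 100%, arbitrarily
slow); the wave equation is written out in divergence form ∑_α ∂_α((η^{αβ} − (2μ(t*)/r) ℓ^α ℓ^β) ∂_β
u) = 0 with ℓ♯ = Kerr.nullVector 0, 2μ/r = 2·Kerr.scalarH (μ(t*)) 0 (cone repair 2026-08-15: this is
verbatim the delta-unfolding of `KerrSchild.waveOperator (KerrSchild.inverseMetric (2μ(x⁰)/r) ℓ♯)`,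
Old ↔ New by Iff.rfl, so that the route no longer imports KerrSchildWaveCauchyProblem and its
15-fact Kerr-wave cone). Claim: for every M₀ > 0 there is η₀ > 0 and (a) C < ∞ such that every
smooth u solving □u = 0 on {t* ≥ 0, r > μ(t*)} with compactly supported Cauchy data in {r > M₀} has
coordinate energy ∫_{r ≥ 2μ(τ) − M₀/2} |∂u|²(τ) ≤ C ∫_{r ≥ M₀} |∂u|²(0) for all τ ≥ 0; (b) for every
R a C_R < ∞ with ∫₀^∞ ∫_{2μ(τ)−M₀/2 ≤ r ≤ R} |∂u|² ≤ C_R ∫ (|∂u|² + |∂²u|²)(0) (integrated local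
energy decay los -/
@[route_item "route-FinalStateConjecture-RenormalisedDrift"]
def AdiabaticSchwarzschildEnergyBound : Prop :=
  open Literature.Geometry.Lorentzian in ∀ M₀ : ℝ, 0 < M₀ → ∃ η₀ : ℝ, 0 < η₀ ∧ (∃ C : ENNReal, C ≠ ⊤ ∧ ∀ μ : ℝ → ℝ, ContDiff ℝ ((⊤ : ℕ∞) : WithTop ℕ∞) μ → Monotone μ → μ 0 = M₀ → (∀ t, μ t ≤ 2 * M₀) → (∀ t, deriv μ t ≤ η₀ ∧ |deriv (deriv μ) t| ≤ η₀ / M₀) → ∀ u : E4 → ℝ, ContDiff ℝ ((⊤ : ℕ∞) : WithTop ℕ∞) u → (∀ x : E4, 0 ≤ x 0 → μ (x 0) < E4.spatialNorm x → ∑ α : Fin 4, fderiv ℝ (fun y ↦ ∑ β : Fin 4, ((if α = β then (if α = 0 then (-1 : ℝ) else 1) else 0) - 2 * Kerr.scalarH (μ (y 0)) 0 y * Kerr.nullVector 0 y α * Kerr.nullVector 0 y β) * fderiv ℝ u y (E4.basisVector β)) x (E4.basisVector α) = 0) → HasCompactSupport (fun y : E3 ↦ u (E4.ofTimeSpace 0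 y)) → HasCompactSupport (fun y : E3 ↦ fderiv ℝ u (E4.ofTimeSpace 0 y) (E4.basisVector 0)) → tsupport (fun y : E3 ↦ u (E4.ofTimeSpace 0 y)) ⊆ {y : E3 | M₀ < ‖y‖} → tsupport (fun y : E3 ↦ fderiv ℝ u (E4.ofTimeSpace 0 y) (E4.basisVector 0)) ⊆ {y : E3 | M₀ < ‖y‖} → ∀ τ : ℝ, 0 ≤ τ → ∫⁻ y in {y : E3 | 2 * μ τ - M₀ / 2 ≤ ‖y‖}, (‖fderiv ℝ u (E4.ofTimeSpace τ y)‖₊ : ENNReal) ^ 2 ≤ C * ∫⁻ y in {y : E3 | M₀ ≤ ‖y‖}, (‖fderiv ℝ u (E4.ofTimeSpace 0 y)‖₊ : ENNReal) ^ 2) ∧ (∀ R : ℝ, ∃ C : ENNReal, C ≠ ⊤ ∧ ∀ μ : ℝ → ℝ, ContDiff ℝ ((⊤ : ℕ∞) : WithTop ℕ∞) μ → Monotone μ → μ 0 = M₀ → (∀ t, μ t ≤ 2 * M₀) → (∀ t, deriv μ t ≤ η₀ ∧ |deriv (deriv μ) t| ≤ η₀ / M₀) → ∀ u : E4 → ℝ,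 ContDiff ℝ ((⊤ : ℕ∞) : WithTop ℕ∞) u → (∀ x : E4, 0 ≤ x 0 → μ (x 0) < E4.spatialNorm x → ∑ α : Fin 4, fderiv ℝ (fun y ↦ ∑ β : Fin 4, ((if α = β then (if α = 0 then (-1 : ℝ) else 1) else 0) - 2 * Kerr.scalarH (μ (y 0)) 0 y * Kerr.nullVector 0 y α * Kerr.nullVector 0 y β) * fderiv ℝ u y (E4.basisVector β)) x (E4.basisVector α) = 0) → HasCompactSupport (fun y : E3 ↦ u (E4.ofTimeSpace 0 y)) → HasCompactSupport (fun y : E3 ↦ fderiv ℝ u (E4.ofTimeSpace 0 y) (E4.basisVector 0)) → tsupport (fun y : E3 ↦ u (E4.ofTimeSpace 0 y)) ⊆ {y : E3 | M₀ < ‖y‖} → tsupport (fun y : E3 ↦ fderiv ℝ u (E4.ofTimeSpace 0 y) (E4.basisVector 0)) ⊆ {y : E3 | M₀ < ‖y‖} → ∫⁻ τ in Ioi (0 : ℝ), ∫⁻ y in {y : E3 | 2 * μ τ - M₀ / 2 ≤ ‖y‖ ∧ ‖y‖ ≤ R}, (‖fderiv ℝ u (E4.ofTimeSpace τ y)‖₊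 : ENNReal) ^ 2 ≤ C * ∫⁻ y in {y : E3 | M₀ ≤ ‖y‖}, ((‖fderiv ℝ u (E4.ofTimeSpace 0 y)‖₊ : ENNReal) ^ 2 + (‖iteratedFDeriv ℝ 2 u (E4.ofTimeSpace 0 y)‖₊ : ENNReal) ^ 2))

-- earlier SingleHoleDriftCapture (stmt-FinalStateConjecture-10856, replaced 2026-08-16T23:18:17Z -> stmt-FinalStateConjecture-17393): retired by None — open Literature.Geometry.Lorentzian in ∀ (m₀ χ : ℝ), 0 < m₀ → 0 ≤ χ → χ < 1 → ∃ (L : ℝ) (ε : ENNReal) (R₀ : ℝ), 0 < L ∧ 0 < ε ∧ ∀ (X : Type) [TopologicalSpace X] [ChartedSpace E3 X] [IsManifold (𝓡 3) ((⊤ : ℕ∞) : WithTop ℕ∞) X] [T2Space X] [SecondCoun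
/-- item stmt-FinalStateConjecture-17393 · support · rank 9 · open · by planner
sources: KlainermanSzeftel2023, GiorgiKlainermanSzeftel2022, TeukolskyPress1974, arXiv:gr-qc/0309115
[support] the N = 1 instance of DriftCapture in its rev-4 form (all-accuracy hypothesis `∀ L ε R₀,
IsAdiabaticallyTracked 𝒟 1 m₀ χ ε L R₀`; re-typed five-clause conclusion with RaysStayInClosure,
honest-radii HasExhaustiveCharts, IsFutureOriented): a single black hole tracked window by window at
every accuracy while it absorbs weak persistent radiation and migrates by O(1) in (M, a) settles
down as the Statement demands; implied by DriftCapture (Sketch.lean `single_of_drift`), filed as the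
informative first rung for provers and refuters. [difficulty: open-problem] -/
@[route_item "route-FinalStateConjecture-RenormalisedDrift"]
def SingleHoleDriftCapture : Prop :=
  open Literature.Geometry.Lorentzian in ∀ (m₀ χ : ℝ), 0 < m₀ → 0 ≤ χ → χ < 1 → ∀ (X : Type) [TopologicalSpace X] [ChartedSpace E3 X] [IsManifold (𝓡 3) ((⊤ : ℕ∞) : WithTop ℕ∞) X] [T2Space X] [SecondCountableTopology X] [ConnectedSpace X], ∀ D ∈ admissibleVacuumData X, ∀ 𝒟 : VacuumCauchyDevelopment D, 𝒟.IsMaximal → Summit.FinalStateConjecture.HasCompleteNullInfinity 𝒟.toCauchyDevelopment → (∀ (L : ℝ) (ε : ENNReal) (R₀ : ℝ), 0 < L → 0 < ε → 𝒟.IsAdiabaticallyTracked 1 m₀ χ ε L R₀) → ∃ (O' : Set 𝒟.carrier) (d : FinalStateDecomposition 𝒟.toSpacetime O' 2), (∀ i, Kerr.IsSubextremal (d.mass i) (d.spin i)) ∧ O' = Summit.FinalStateConjecture.exteriorOf 𝒟.toCauchyDevelopment d.charted ∧ Summit.FinalStateConjecture.RaysStayInClosure 𝒟.toCauchyDevelopment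 O' ∧ Summit.FinalStateConjecture.HasExhaustiveCharts d ∧ Summit.FinalStateConjecture.IsFutureOriented d

/-- item stmt-FinalStateConjecture-9937 · support · rank 9 · open · by planner
sources: ChoquetBruhatGeroch1969CMP, Ringstrom2009, Sbierski2016AHP
[support] every admissible datum has a maximal globally hyperbolic vacuum development, stated over
the repaired structure `VacuumCauchyDevelopment` (the corrected form of the deprecated
`choquetBruhat_geroch_exists_mghd`, recorded in `CauchyProblemExistenceDefect`);
Choquet-Bruhat–Geroch 1969 Thm. 3, Sbierski 2016 Thm. 2.6. Known theorem; large formalisation;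
shared by every route of this summit. [difficulty: XL] -/
@[route_item "route-FinalStateConjecture-RenormalisedDrift"]
def MGHDExists : Prop :=
  ∀ (X : Type) [TopologicalSpace X] [ChartedSpace Literature.Geometry.Lorentzian.E3 X] [IsManifold (𝓡 3) ((⊤ : ℕ∞) : WithTop ℕ∞) X] [T2Space X] [SecondCountableTopology X] [ConnectedSpace X], ∀ D ∈ Literature.Geometry.Lorentzian.admissibleVacuumData X, ∃ 𝒟 : Literature.Geometry.Lorentzian.VacuumCauchyDevelopment D, 𝒟.IsMaximal

-- earlier Assembly (stmt-FinalStateConjecture-10857, replaced 2026-08-16T23:20:46Z -> stmt-FinalStateConjecture-17505): retired by None — DriftCapture → AdiabaticTracking → MGHDExists → FinalStateConjecture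
/-- item stmt-FinalStateConjecture-17505 · assembly · rank 1 · open · by planner
sources: DafermosLuk2017, Christodoulou1999
[assembly] DriftCapture → AdiabaticTracking → FinalStateConjecture (the sub-problem Statement decl,
root level); crux-only since rev 5 (= `closes`). -/
@[route_item "route-FinalStateConjecture-RenormalisedDrift"]
def Assembly : Prop :=
  DriftCapture → AdiabaticTracking → FinalStateConjecture

/-! D-0027 §2.1 — DECIDING THEOREM (planner-authored via `route open/edit --closes-file`; by planner-rbadge-FinalStateConjecture-Renormalis-7fb85d4e-0 2026-08-16T23:41:28Z):
its hypotheses are this route's items and its conclusion the sub-problem Statement (glue_lint), and it elaborates with this file. -/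

/-- DECIDING THEOREM (D-0027 §2.1), crux-only (ruling 2026-08-16), re-certified 2026-08-16 by the
route-repair planner after a stale fullbuild stamp (the failing build compiled a pre-rev-4 rendering
of this file against the re-typed Statement p126844; rev 5 elaborates natively, lean check rc 0):
pointwise on the admissible class, the tame-generic property of AdiabaticTracking (an MGHD exists;
every MGHD has complete 𝓘⁺ and, for its own (N, m₀, χ), is adiabatically tracked at EVERY
accuracy) + DriftCapture (all-accuracy hypothesis ⇒ the Statement's settling clause verbatim:
sub-extremal holes, O = exteriorOf d.charted, RaysStayInClosure, HasExhaustiveCharts with honest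
radii, IsFutureOriented) give the Statement's property; TAME Christodoulou genericity
(`IsTameChristodoulouGeneric`, one fixed end) is monotone under pointwise implication on the
admissible class: the exceptional datum's tame immersed escaping family for the weaker property
serves verbatim (end `e`, family `F`, tameness, immersion, base point, injectivity, admissibility
are kept; only the escape clause is transported). The shared known support MGHDExists
(Choquet-Bruhat–Geroch) is no hypothesis: it is the rung discharging AdiabaticTracking's
anti-vacuity conjunct. -/
@[closes "route-FinalStateConjecture-RenormalisedDrift"] theorem closes : DriftCapture → AdiabaticTracking → _root_.FinalStateConjecture := by
  intro h₁ h₂ X _ _ _ _ _ _ d hd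
  have key : ∀ D ∈ Literature.Geometry.Lorentzian.admissibleVacuumData X,
      ((∃ 𝒟 : Literature.Geometry.Lorentzian.VacuumCauchyDevelopment D, 𝒟.IsMaximal) ∧
        ∀ 𝒟 : Literature.Geometry.Lorentzian.VacuumCauchyDevelopment D, 𝒟.IsMaximal →
        Summit.FinalStateConjecture.HasCompleteNullInfinity 𝒟.toCauchyDevelopment ∧
        ∃ (N : ℕ) (m₀ χ : ℝ), 0 < m₀ ∧ 0 ≤ χ ∧ χ < 1 ∧ ∀ (L : ℝ) (ε : ENNReal) (R₀ : ℝ),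
          0 < L → 0 < ε → 𝒟.IsAdiabaticallyTracked N m₀ χ ε L R₀) →
      ((∃ 𝒟 : Literature.Geometry.Lorentzian.VacuumCauchyDevelopment D, 𝒟.IsMaximal) ∧
        ∀ 𝒟 : Literature.Geometry.Lorentzian.VacuumCauchyDevelopment D, 𝒟.IsMaximal →
          Summit.FinalStateConjecture.HasCompleteNullInfinity 𝒟.toCauchyDevelopment ∧
            ∃ (O : Set 𝒟.carrier) (d : Literature.Geometry.Lorentzian.FinalStateDecomposition
              𝒟.toSpacetime O 2),
              (∀ i, Literature.Geometry.Lorentzian.Kerr.IsSubextremal (d.mass i) (d.spin i)) ∧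
                O = Summit.FinalStateConjecture.exteriorOf 𝒟.toCauchyDevelopment d.charted ∧
                  Summit.FinalStateConjecture.RaysStayInClosure 𝒟.toCauchyDevelopment O ∧
                    Summit.FinalStateConjecture.HasExhaustiveCharts d ∧
                      Summit.FinalStateConjecture.IsFutureOriented d) := by
    rintro D hD ⟨hex, h⟩
    refine ⟨hex, fun 𝒟 hmax ↦ ⟨(h 𝒟 hmax).1, ?_⟩⟩
    obtain ⟨N, m₀, χ, hm₀, hχ₀, hχ₁, hT⟩ := (h 𝒟 hmax).2
    exact h₁ N m₀ χ hm₀ hχ₀ hχ₁ X D hD 𝒟 hmax (h 𝒟 hmax).1 hT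
  obtain ⟨e, F, hF, himm, h0, hinj, hadm, hE⟩ := h₂ X d ⟨hd.1, fun h ↦ hd.2 (key d hd.1 h)⟩
  exact ⟨e, F, hF, himm, h0, hinj, hadm,
    fun c hc hmem ↦ hE c hc ⟨hmem.1, fun h ↦ hmem.2 (key (F c) hmem.1 h)⟩⟩

end Summit.FinalStateConjecture.FinalStateConjecture.Theses.RenormalisedDrift
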